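import Mathlib
import Summits.Ventures.HodgeRepro2.T5MuInvariantDVR
import Summits.Ventures.HodgeRepro2.T5FiniteZerosExtensionUnion
import Summits.Ventures.HodgeRepro2.T5FiniteZerosExtensionInfinite
import Summits.Ventures.HodgeRepro2.T6N5PropG

/-!
# T5PropGBranchModel — route-3's Proposition G on one branch, INSTANTIATED in the measure model:
t6-p7's `GBranch` built from a W-valued measure on Γ⁻, and its `Hyps` from the printed displays alone

Tier-5 support for route-3's §G (route/T5-CHECK-G-p7.md §3 S1–S5, §20–§22) and for the M2
composition of N5 (t6-p7's T6N5PropG, p400802).  `GBranch.Hyps` of that file lists the inputs of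
Proposition G on one branch as eight fields; three of them are sentences about the 𝔭-adic measures
([A-3] `twist`: the λ⁻¹-branch and the χ-branch have the same μ-invariant; S1 `nonzero`: a measure
of finite μ-invariant is non-zero; S5 `finite_of_nonzero`: a non-zero measure on the 𝔭-line kills
only finitely many characters), the other five are the printed displays ([P1] Hsieh's Theorem A
`hsieh` with its local terms `local_finite`, the sign `sign`, [P2] Burungale–Hida's Theorem B `bh`,
[P4] the interpolation transfer `interp`).

This file builds the branch from the model's objects — `ModelData`: the Hsieh measure
ℒ⁻_{χ,Σ} = `M` on a profinite Γ⁻ = `X` with values in a complete DVR `A` (W = W(𝔽̄_p), with its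
valuation / norm dictionary `NormDict`), the unit-valued continuous character `ν` (with inverse `ν'`)
such that L⁻_{Σ,λ⁻¹} = ν̃·ℒ⁻_{χ,Σ} (S4), the projection `π : Γ⁻ → Γ_𝔭 ≅ ℤ_p`, the character ring
`R'` (𝒪_{ℂ_p}) with `A ↪ R'` isometric and injective, a field `K` receiving `R'`, the complex
central values `L`, the places `condMinus` with the local invariants `muLoc`, the root number — and
proves the three measure-theoretic fields as THEOREMS of the model (`toBranch_twist`,
`toBranch_nonzero`, `toBranch_finite_of_nonzero`), so that **`ModelData.hyps`** derives
`(D.toBranch).Hyps` from exactly the five display-shaped hypotheses, **`ModelData.cofiniteNonvanishing`**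
is Proposition G (i) for the branch and **`exists_twist_of_family`** is (ii) + the admissible choice
for a finite family of branches (one ν serves all four line characters) over a character ring with
infinitely many p-power roots of unity.

`GBranch ι Ξ K` asks for a FIELD `K` of values while the model's values lie in the domain `R'`;
`mapValues` transports branch data along the injective `f : R' →+* K` (nothing is lost:
`finitelyManyZeros_mapValues`, `interpolationTransfer_mapValues_iff`).

No printed input is consumed.  §8(d): uses an L-value-free non-vanishing device: NO.
-/

namespace Summit.Ventures.HodgeRepro2.T5PropGBranchModel

open Summit.Ventures.HodgeRepro2.T5PropGSkeleton
open Summit.Ventures.HodgeRepro2.T5MeasureSupOnClopens (twist twist_bound twist_apply)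
open Summit.Ventures.HodgeRepro2.T5PushforwardMeasure (pushforward norm_pushforward_le
  pushforward_apply)
open Summit.Ventures.HodgeRepro2.T5MuInvariantDVR
open Summit.Ventures.HodgeRepro2.T5FiniteZerosExtension (extend)
open Summit.Ventures.HodgeRepro2.T5PropGBranchMeasure (branchData)
open Summit.Ventures.HodgeRepro2.T6.N5PropG

section MapValues

variable {Ξ W W' : Type*} [Ring W] [Ring W']

/-- Transport of branch data along a ring homomorphism of the coefficient rings: the same twists,
the same complex values, the 𝔭-adic values pushed through `f`. -/
def mapValues (f : W →+* W') (d : BranchData Ξ W) : BranchData Ξ W' where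
  L := d.L
  m ν := f (d.m ν)
  inv := d.inv

/-- `(mapValues f d).L = d.L`. -/
@[simp] theorem mapValues_L (f : W →+* W') (d : BranchData Ξ W) : (mapValues f d).L = d.L := rfl

/-- `(mapValues f d).m ν = f (d.m ν)`. -/
@[simp] theorem mapValues_m (f : W →+* W') (d : BranchData Ξ W) (ν : Ξ) :
    (mapValues f d).m ν = f (d.m ν) := rfl

/-- `(mapValues f d).inv = d.inv`. -/
@[simp] theorem mapValues_inv (f : W →+* W') (d : BranchData Ξ W) :
    (mapValues f d).inv = d.inv := rfl

/-- Along an injective `f` the zero set of the 𝔭-adic values is unchanged. -/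
theorem zeroSet_mapValues (f : W →+* W') (hf : Function.Injective f) (d : BranchData Ξ W) :
    {ν | (mapValues f d).m ν = 0} = {ν | d.m ν = 0} := by
  ext ν
  simp only [Set.mem_setOf_eq, mapValues_m, map_eq_zero_iff f hf]

/-- `FinitelyManyZeros` is transported along an injective `f`. -/
theorem finitelyManyZeros_mapValues (f : W →+* W') (hf : Function.Injective f)
    {d : BranchData Ξ W} (h : FinitelyManyZeros d) : FinitelyManyZeros (mapValues f d) := by
  unfold FinitelyManyZeros at h ⊢
  rwa [zeroSet_mapValues f hf]

/-- `InterpolationTransfer` is unchanged by an injective `f`. -/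
theorem interpolationTransfer_mapValues_iff (f : W →+* W') (hf : Function.Injective f)
    (d : BranchData Ξ W) : InterpolationTransfer (mapValues f d) ↔ InterpolationTransfer d := by
  unfold InterpolationTransfer
  simp only [mapValues_m, mapValues_L, mapValues_inv, ne_eq, map_eq_zero_iff f hf]

/-- `CofiniteNonvanishing` only sees the complex values, which `mapValues` keeps. -/
theorem cofiniteNonvanishing_mapValues_iff (f : W →+* W') (d : BranchData Ξ W) :
    CofiniteNonvanishing (mapValues f d) ↔ CofiniteNonvanishing d := Iff.rfl

end MapValues

section Model

variable (p : ℕ) [Fact (Nat.Prime p)]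
variable (X : Type*) [TopologicalSpace X] [CompactSpace X]
variable (A : Type*) [NormedCommRing A] [IsDomain A] [IsDiscreteValuationRing A]
variable (R' : Type*) [NormedCommRing R'] [Algebra A R']
variable (K : Type*) [Field K]
variable (ι : Type*)

/-- The objects of one branch of Proposition G in the measure model (CHECK-G §3 S1–S6):
the Hsieh measure `M` = ℒ⁻_{χ,Σ} on Γ⁻ = `X`, bounded by `C`; the valuation / norm dictionary
of the coefficient ring; the unit-valued character `ν` (inverse `ν'`) with L⁻_{Σ,λ⁻¹} = ν̃·ℒ⁻_{χ,Σ};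
the projection `π` to Γ_𝔭 ≅ ℤ_p; the isometric injective embedding of the coefficient ring into
the character ring `R'` (W ↪ 𝒪_{ℂ_p}) and a field embedding `f : R' →+* K`; the complex central
values `L` (ν ↦ L(1, λν)); the places `condMinus` (v | 𝔠⁻) with the local invariants `muLoc`
(μ_p(χ_v)); the global root number. -/
structure ModelData where
  /-- the Hsieh measure ℒ⁻_{χ,Σ} on Γ⁻, an `A`-valued bounded functional on `C(X, A)`. -/
  M : C(X, A) →ₗ[A] A
  /-- a bound for `M`. -/
  C : ℝ
  /-- `0 ≤ C`. -/
  hC : 0 ≤ C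
  /-- `‖M φ‖ ≤ C * ‖φ‖`. -/
  hM : ∀ φ : C(X, A), ‖M φ‖ ≤ C * ‖φ‖
  /-- the absolute value of a uniformiser of `A`. -/
  r : ℝ
  /-- the norm / valuation dictionary of `A` (T5MuInvariantDVR's `NormDict`). -/
  hd : NormDict A r
  /-- the unit-valued continuous character ν̃ of S4. -/
  ν : C(X, A)
  /-- its inverse. -/
  ν' : C(X, A)
  /-- `ν * ν' = 1`. -/
  hν : ν * ν' = 1
  /-- the projection Γ⁻ → Γ_𝔭 ≅ ℤ_p. -/
  π : C(X, ℤ_[p])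
  /-- the embedding of the coefficient ring into the character ring is norm-non-increasing. -/
  hφ : ∀ x : A, ‖algebraMap A R' x‖ ≤ ‖x‖
  /-- and injective. -/
  hφi : Function.Injective (algebraMap A R')
  /-- a field embedding of the character ring (𝒪_{ℂ_p} ↪ ℂ_p, or the fraction field). -/
  f : R' →+* K
  /-- `f` is injective. -/
  hf : Function.Injective f
  /-- the complex central values ν ↦ L(1, λν) on the continuous characters of Γ_𝔭 with values
  in the character ring. -/
  L : {κ : AddChar ℤ_[p] R' // Continuous ⇑κ} → ℂ
  /-- the places v | 𝔠⁻. -/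
  condMinus : Finset ι
  /-- the local invariants μ_p(χ_v). -/
  muLoc : ι → ℕ∞
  /-- the global root number W(χ̌). -/
  rootNumber : ℤ

namespace ModelData

variable {p X A R' K ι}
variable (D : ModelData p X A R' K ι)

/-- The λ⁻¹-branch measure L⁻_{Σ,λ⁻¹} = ν̃·ℒ⁻_{χ,Σ} on Γ⁻ (S4's twist identity). -/
noncomputable def Mlam : C(X, A) →ₗ[A] A := twist D.ν D.M

/-- `‖Mlam φ‖ ≤ C * ‖φ‖` (the twist by a unit-valued function keeps the bound). -/
theorem Mlam_bound (φ : C(X, A)) : ‖D.Mlam φ‖ ≤ D.C * ‖φ‖ :=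
  twist_bound D.hd.norm_le_one D.ν D.M D.hC D.hM φ

/-- The 𝔭-line measure L⁻_{Σ,λ⁻¹,𝔭} = π_*(L⁻_{Σ,λ⁻¹}) on Γ_𝔭 ≅ ℤ_p (S1). -/
noncomputable def Mp : C(ℤ_[p], A) →ₗ[A] A := pushforward D.π D.Mlam

/-- `‖Mp ψ‖ ≤ C * ‖ψ‖` (the push-forward keeps the bound). -/
theorem Mp_bound (ψ : C(ℤ_[p], A)) : ‖D.Mp ψ‖ ≤ D.C * ‖ψ‖ :=
  norm_pushforward_le D.π D.Mlam D.hC D.Mlam_bound ψ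

/-- S1 AS A THEOREM (measure side): a 𝔭-line measure of finite μ-invariant is non-zero —
`muV_eq_top_iff_eq_zero` on Γ_𝔭 ≅ ℤ_p. -/
theorem Mp_ne_zero_of_muV_lt_top (h : muV D.Mp < ⊤) : D.Mp ≠ 0 :=
  ne_zero_of_muV_lt_top D.Mp D.hC D.Mp_bound h

/-- [A-3] AS A THEOREM (measure side): the λ⁻¹-branch and the χ-branch have the same μ-invariant
— S4's twist invariance `muV_twist` over W. -/
theorem muV_Mlam [T2Space X] [TotallyDisconnectedSpace X] [IsUltrametricDist A] :
    muV D.Mlam = muV D.M :=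
  muV_twist D.hd D.ν D.ν' D.hν D.M D.hC D.hM

variable [Algebra ℤ_[p] A] [IsBoundedSMul ℤ_[p] A]
variable [Algebra ℤ_[p] R'] [IsBoundedSMul ℤ_[p] R'] [IsUltrametricDist R'] [CompleteSpace R']

/-- The 𝔭-line measure extended to the character ring: L⁻_{Σ,λ⁻¹,𝔭} ⊗ 𝒪_{ℂ_p} (§84). -/
noncomputable def E : C(ℤ_[p], R') →ₗ[R'] R' := extend D.Mp D.Mp_bound D.hφ

/-- The branch of Proposition G attached to the model data, as t6-p7's `GBranch`: the twists are
the continuous characters of Γ_𝔭 ≅ ℤ_p with values in the character ring, the 𝔭-adic values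
`∫ν dL⁻_{Σ,λ⁻¹,𝔭}` (read in `K` through `f`), the inversion ν ↦ ν⁻¹, the three μ-invariants
μ(ℒ⁻_{χ,Σ}), μ(L⁻_{Σ,λ⁻¹}), μ(L⁻_{Σ,λ⁻¹,𝔭}) as `muV` of the model's measures, and
«the 𝔭-line measure is non-zero» literally. -/
noncomputable def toBranch : GBranch ι {κ : AddChar ℤ_[p] R' // Continuous ⇑κ} K where
  toBranchData := mapValues D.f (branchData D.E D.L)
  condMinus := D.condMinus
  muLoc := D.muLoc
  muHsieh := muV D.M
  muBH := muV D.Mlam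
  muBHp := muV D.Mp
  rootNumber := D.rootNumber
  measureNeZero := D.Mp ≠ 0

/-- `D.toBranch.toBranchData = mapValues D.f (branchData D.E D.L)`. -/
@[simp] theorem toBranch_toBranchData :
    D.toBranch.toBranchData = mapValues D.f (branchData D.E D.L) := rfl

/-- `D.toBranch.muHsieh = muV D.M`. -/
@[simp] theorem toBranch_muHsieh : D.toBranch.muHsieh = muV D.M := rfl

/-- `D.toBranch.muBH = muV D.Mlam`. -/
@[simp] theorem toBranch_muBH : D.toBranch.muBH = muV D.Mlam := rfl

/-- `D.toBranch.muBHp = muV D.Mp`. -/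
@[simp] theorem toBranch_muBHp : D.toBranch.muBHp = muV D.Mp := rfl

/-- `D.toBranch.measureNeZero = (D.Mp ≠ 0)`. -/
@[simp] theorem toBranch_measureNeZero : D.toBranch.measureNeZero = (D.Mp ≠ 0) := rfl

/-- `D.toBranch.rootNumber = D.rootNumber`. -/
@[simp] theorem toBranch_rootNumber : D.toBranch.rootNumber = D.rootNumber := rfl

/-- `D.toBranch.condMinus = D.condMinus`. -/
@[simp] theorem toBranch_condMinus : D.toBranch.condMinus = D.condMinus := rfl

/-- `D.toBranch.muLoc = D.muLoc`. -/
@[simp] theorem toBranch_muLoc : D.toBranch.muLoc = D.muLoc := rfl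

/-- `D.toBranch.L = D.L`. -/
@[simp] theorem toBranch_L : D.toBranch.L = D.L := rfl

/-- [A-3] AS A THEOREM: `GBranch.Hyps.twist` for the model branch. -/
theorem toBranch_twist [T2Space X] [TotallyDisconnectedSpace X] [IsUltrametricDist A] :
    D.toBranch.muBH = D.toBranch.muHsieh :=
  D.muV_Mlam

/-- S1 AS A THEOREM: `GBranch.Hyps.nonzero` for the model branch. -/
theorem toBranch_nonzero (h : D.toBranch.muBHp < ⊤) : D.toBranch.measureNeZero :=
  D.Mp_ne_zero_of_muV_lt_top h

/-- S5 AS A THEOREM: a non-zero 𝔭-line measure kills only finitely many characters of Γ_𝔭 with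
values in the character ring (`GBranch.Hyps.finite_of_nonzero`) — §86's
`finitelyManyZeros_branchData_extend` (Amice transform, Weierstrass preparation over W, the zero
count in the domain 𝒪_{ℂ_p}), transported along `f`. -/
theorem toBranch_finite_of_nonzero [IsUltrametricDist A] [CompleteSpace A]
    [IsAdicComplete (IsLocalRing.maximalIdeal A) A] [IsLinearTopology R' R'] [IsDomain R']
    (h : D.toBranch.measureNeZero) : FinitelyManyZeros D.toBranch.toBranchData :=
  finitelyManyZeros_mapValues D.f D.hf
    (T5FiniteZerosExtensionUnion.finitelyManyZeros_branchData_extend D.Mp D.Mp_bound D.hφ D.hφi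
      h D.L)

variable [T2Space X] [TotallyDisconnectedSpace X] [IsUltrametricDist A] [CompleteSpace A]
  [IsAdicComplete (IsLocalRing.maximalIdeal A) A] [IsLinearTopology R' R'] [IsDomain R']

omit [T2Space X] [TotallyDisconnectedSpace X] in
/-- S5's COUNT for the model branch: the twists killed by the 𝔭-line measure number at most
λ(f_{Mp}), the λ-invariant of its Amice transform over W (§84's
`ncard_zeroSet_extend_le_lambdaSeries`; the zero set is unchanged by `f`). -/
theorem ncard_zeroSet_le_lambdaSeries (h : D.Mp ≠ 0) :
    {ν | D.toBranch.m ν = 0}.ncard ≤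
      T5LambdaInvariantDVR.lambdaSeries (T5AmiceTransform.amice D.Mp) := by
  have hz : {ν | D.toBranch.m ν = 0} = {ν | (branchData D.E D.L).m ν = 0} :=
    zeroSet_mapValues D.f D.hf _
  rw [hz]
  exact T5FiniteZerosExtension.ncard_zeroSet_extend_le_lambdaSeries D.Mp D.Mp_bound D.hφ D.hφi h

/-- PROPOSITION G's HYPOTHESES FROM THE DISPLAYS ALONE: `GBranch.Hyps` for the model branch
follows from the five display-shaped hypotheses — [P1] `hsieh` (Hsieh's Theorem A for the
χ-branch: W(χ̌) = 1 ⇒ μ(ℒ⁻_{χ,Σ}) = Σ_{v|𝔠⁻} μ_p(χ_v)), S4 `local_finite`, (H4) `sign`,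
[P2] `bh` (Burungale–Hida's Theorem B: μ(L⁻_{Σ,λ⁻¹}) = μ(L⁻_{Σ,λ⁻¹,𝔭})) and [P4] `interp`
(S6 for the extended branch data: ∫ν dL⁻_{Σ,λ⁻¹,𝔭} ≠ 0 ⇒ L(1, λν⁻¹) ≠ 0) — the fields
`twist`, `nonzero`, `finite_of_nonzero` being the theorems above. -/
theorem hyps (hsieh : D.rootNumber = 1 → muV D.M = ∑ v ∈ D.condMinus, D.muLoc v)
    (local_finite : ∀ v ∈ D.condMinus, D.muLoc v < ⊤) (sign : D.rootNumber = 1)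
    (bh : muV D.Mlam = muV D.Mp) (interp : InterpolationTransfer (branchData D.E D.L)) :
    D.toBranch.Hyps where
  hsieh := hsieh
  local_finite := local_finite
  sign := sign
  twist := D.toBranch_twist
  bh := bh
  nonzero := D.toBranch_nonzero
  finite_of_nonzero := D.toBranch_finite_of_nonzero
  interp := (interpolationTransfer_mapValues_iff D.f D.hf (branchData D.E D.L)).2 interp

/-- Proposition G (i) for the model branch: `L(1, λν) ≠ 0` for all but finitely many continuous
characters ν of Γ_𝔭 with values in the character ring, from the five displays
(t6-p7's `GBranch.cofiniteNonvanishing`). -/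
theorem cofiniteNonvanishing (hsieh : D.rootNumber = 1 → muV D.M = ∑ v ∈ D.condMinus, D.muLoc v)
    (local_finite : ∀ v ∈ D.condMinus, D.muLoc v < ⊤) (sign : D.rootNumber = 1)
    (bh : muV D.Mlam = muV D.Mp) (interp : InterpolationTransfer (branchData D.E D.L)) :
    {ν | D.L ν = 0}.Finite :=
  GBranch.cofiniteNonvanishing (D.hyps hsieh local_finite sign bh interp)

/-- The 𝔭-line measure of the model branch is non-zero from the displays (S1–S4 composed). -/
theorem Mp_ne_zero (hsieh : D.rootNumber = 1 → muV D.M = ∑ v ∈ D.condMinus, D.muLoc v)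
    (local_finite : ∀ v ∈ D.condMinus, D.muLoc v < ⊤) (sign : D.rootNumber = 1)
    (bh : muV D.Mlam = muV D.Mp) (interp : InterpolationTransfer (branchData D.E D.L)) :
    D.Mp ≠ 0 :=
  GBranch.measure_ne_zero (D.hyps hsieh local_finite sign bh interp)

end ModelData

end Model

section Family

variable {p : ℕ} [Fact (Nat.Prime p)]
variable {R' : Type*} [NormedCommRing R']

/-- Over a character ring with infinitely many p-power roots of unity (𝒪_{ℂ_p}) the twist family
Ξ_𝔭 of the model is infinite (§87's `infinite_finiteOrderChars`). -/
theorem infinite_twists (hR : {ζ : R' | ∃ k : ℕ, ζ ^ p ^ k = 1}.Infinite) :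
    (Set.univ : Set {κ : AddChar ℤ_[p] R' // Continuous ⇑κ}).Infinite := by
  have h1 : {κ : AddChar ℤ_[p] R' | Continuous ⇑κ}.Infinite :=
    (T5FiniteZerosExtensionInfinite.infinite_finiteOrderChars hR).mono fun κ hκ => hκ.1
  have h2 : Infinite {κ : AddChar ℤ_[p] R' // Continuous ⇑κ} := h1.to_subtype
  exact Set.infinite_univ

variable {X : Type*} [TopologicalSpace X] [CompactSpace X] [T2Space X] [TotallyDisconnectedSpace X]
variable {A : Type*} [NormedCommRing A] [Algebra ℤ_[p] A] [IsBoundedSMul ℤ_[p] A]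
  [IsUltrametricDist A] [CompleteSpace A] [IsDomain A] [IsDiscreteValuationRing A]
  [IsAdicComplete (IsLocalRing.maximalIdeal A) A]
variable [Algebra A R'] [Algebra ℤ_[p] R'] [IsBoundedSMul ℤ_[p] R']
  [IsUltrametricDist R'] [CompleteSpace R'] [IsLinearTopology R' R'] [IsDomain R']
variable {K : Type*} [Field K] {ι : Type*}

/-- Proposition G (ii) + the admissible choice, for a finite family of model branches (the four
line characters λ_i of a rank-four face): from the five displays of EACH branch, ONE continuous
character ν of Γ_𝔭 (with values in a character ring carrying infinitely many p-power roots of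
unity) has `L_i(1, λ_iν) ≠ 0` for every branch (t6-p7's `exists_twist_of_hyps`). -/
theorem exists_twist_of_family (hR : {ζ : R' | ∃ k : ℕ, ζ ^ p ^ k = 1}.Infinite) {J : Type*}
    (I : Finset J) (D : J → ModelData p X A R' K ι)
    (hsieh : ∀ i ∈ I, (D i).rootNumber = 1 → muV (D i).M = ∑ v ∈ (D i).condMinus, (D i).muLoc v)
    (local_finite : ∀ i ∈ I, ∀ v ∈ (D i).condMinus, (D i).muLoc v < ⊤)
    (sign : ∀ i ∈ I, (D i).rootNumber = 1)
    (bh : ∀ i ∈ I, muV (D i).Mlam = muV (D i).Mp)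
    (interp : ∀ i ∈ I, InterpolationTransfer (branchData (D i).E (D i).L)) :
    ∃ ν : {κ : AddChar ℤ_[p] R' // Continuous ⇑κ}, ∀ i ∈ I, (D i).L ν ≠ 0 :=
  exists_twist_of_hyps (infinite_twists hR) I (fun i => (D i).toBranch) fun i hi =>
    (D i).hyps (hsieh i hi) (local_finite i hi) (sign i hi) (bh i hi) (interp i hi)

/-- PROPOSITION G (i)–(iii) for a finite family of model branches (route-3's §G for the four line
characters; §8's `propG`): from the five displays of each branch and the sign data of S8
(`SignConstant` + the base value +1, as in p401712's `propG_extend`): every branch's complex values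
vanish on a finite set, so does their product, and every sign is +1. -/
theorem propG_family {J : Type*} (I : Finset J) (D : J → ModelData p X A R' K ι)
    (hsieh : ∀ i ∈ I, (D i).rootNumber = 1 → muV (D i).M = ∑ v ∈ (D i).condMinus, (D i).muLoc v)
    (local_finite : ∀ i ∈ I, ∀ v ∈ (D i).condMinus, (D i).muLoc v < ⊤)
    (sign : ∀ i ∈ I, (D i).rootNumber = 1)
    (bh : ∀ i ∈ I, muV (D i).Mlam = muV (D i).Mp)
    (interp : ∀ i ∈ I, InterpolationTransfer (branchData (D i).E (D i).L))
    (eps : J → {κ : AddChar ℤ_[p] R' // Continuous ⇑κ} → ℤ) (one : {κ : AddChar ℤ_[p] R' // Continuous ⇑κ})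
    (hS8 : ∀ i ∈ I, SignConstant (eps i) one) (hone : ∀ i ∈ I, eps i one = 1) :
    (∀ i ∈ I, {ν | (D i).L ν = 0}.Finite) ∧ {ν | ∏ i ∈ I, (D i).L ν = 0}.Finite ∧
      ∀ i ∈ I, ∀ ν, eps i ν = 1 :=
  propG I (fun i => (D i).toBranch.toBranchData)
    (fun i hi => GBranch.finitelyManyZeros
      ((D i).hyps (hsieh i hi) (local_finite i hi) (sign i hi) (bh i hi) (interp i hi)))
    (fun i hi => GBranch.interpolationTransfer
      ((D i).hyps (hsieh i hi) (local_finite i hi) (sign i hi) (bh i hi) (interp i hi)))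
    eps one hS8 hone

omit [T2Space X] [TotallyDisconnectedSpace X] in
/-- S7's COUNT for a family of model branches: the twists killed by SOME 𝔭-line measure of the
family number at most Σ_i λ(f_{Mp_i}) (p401712's `ncard_biUnion_zeroSet_extend_le_sum_lambdaSeries`;
the zero sets are unchanged by the field embeddings). -/
theorem ncard_biUnion_zeroSet_le_sum_lambdaSeries {J : Type*} (I : Finset J)
    (D : J → ModelData p X A R' K ι) (hφ : ∀ x : A, ‖algebraMap A R' x‖ ≤ ‖x‖)
    (hφi : Function.Injective (algebraMap A R')) (hne : ∀ i ∈ I, (D i).Mp ≠ 0) :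
    (⋃ i ∈ I, {ν | (D i).toBranch.m ν = 0}).ncard ≤
      ∑ i ∈ I, T5LambdaInvariantDVR.lambdaSeries (T5AmiceTransform.amice (D i).Mp) := by
  have hz : ∀ i, {ν | (D i).toBranch.m ν = 0} =
      T5FiniteZerosUnion.zeroSet (extend (D i).Mp (D i).Mp_bound hφ) := by
    intro i
    rw [T5FiniteZerosExtensionUnion.zeroSet_extend_eq, ModelData.toBranch_toBranchData,
      zeroSet_mapValues (D i).f (D i).hf]
    rfl
  simp only [hz]
  exact T5FiniteZerosExtensionUnion.ncard_biUnion_zeroSet_extend_le_sum_lambdaSeries I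
    (fun i => (D i).Mp) (fun i => (D i).C) (fun i => (D i).Mp_bound) hφ hφi hne

end Family

end Summit.Ventures.HodgeRepro2.T5PropGBranchModel
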